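import Summits.Ventures.PercRepro.SixThreeShares

/-!
# PercRepro — the `(7,3)` cell: THEOREM P₂(7,3), the `|B| ≥ 4` step (p3, gen 15)

mine-2 §26.3: for a plane `G`, a rank-`3` subset `B ⊆ G` with `|B| ≥ 4` and a `7`-point set `W` outside `G` spanning
rank `7` together with `B`, the witnesses `B ∪ {x}` and `B ∪ {x, x′}` alone supply `T`… more than `Φ(7,3) = 28/5`.
With the share bounds of the `(6,3)` chain (`SixThreeShares.lean`: singles `≥ 2/5`, generic pairs `≥ 3/14`, lossy pairs
`≥ 3/32`) the only new ingredient is a COUNT: a point `x ∈ W` has at most `3` lossy partners `x′ ∈ W` (`x′ ∈ cl(B ∪ x)`),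
because `ρ(B ∪ W) = 7` forces at least `7 − ρ(B ∪ x) = 3` points of `W` outside `cl(B ∪ x)` (`card_lossy_le_three`).
Summing over ORDERED pairs, each `x` contributes `≥ 3·(3/14) + 3·(3/32) = 207/224`, so the unordered pairs supply
`≥ 7·207/448 ≈ 3.23`, and with the singles `7·(2/5) = 2.8` the total is `≥ 6.03 > 5.6` (`supply_ge_phi_of_four_le`).
(The dossier's §26.3 uses the triples as well and reaches `9.49`; the pairs suffice.)
-/

namespace PercRepro

namespace SevenThree

open Finset ThmH SixThree

variable {α : Type*} [DecidableEq α] {M : Matroid α} [M.Finite]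

open scoped Classical

/-- A point of the ground set outside `cl(F)` raises the rank of `F` by one (local copy of `SevenThreePhi.lean`'s lemma, so
that this module imports the landed `SixThreeShares` only). -/
theorem eRk_insert_eq_succ_of_notMem_closure' {F : Finset α} {e : α} (he : e ∈ gr M)
    (hecl : e ∉ M.closure (F : Set α)) :
    M.eRk ((insert e F : Finset α) : Set α) = M.eRk (F : Set α) + 1 := by
  have heE : e ∈ M.E := by rw [← coe_gr M]; exact_mod_cast he
  rw [Finset.coe_insert]
  exact Matroid.eRk_insert_eq_add_one ⟨heE, hecl⟩

/-- **The lossy partners of `x`**: at most `3` points of `W ∖ x` lie in `cl(B ∪ x)` when `ρ(B ∪ W) = 7`, `ρ(B) = 3`,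
`x ∈ W` outside the plane of `B`. -/
theorem card_lossy_le_three {G B W : Finset α} (hG : G ∈ planes M) (hB : B ⊆ G) (hrB : M.eRk (B : Set α) = 3)
    (hW : W ⊆ gr M) (hWG : Disjoint W G) (hW7 : W.card = 7) (hBW : M.eRk ((B ∪ W : Finset α) : Set α) = 7)
    {x : α} (hx : x ∈ W) :
    ((W.erase x).filter (fun x' => x' ∈ M.closure ((insert x B : Finset α) : Set α))).card ≤ 3 := by
  classical
  have hxG : x ∉ G := Finset.disjoint_left.1 hWG hx
  have hr4 : M.eRk ((insert x B : Finset α) : Set α) = 4 := eRk_insert_eq_four hG hB hrB (hW hx) hxG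
  -- the points of `W` outside `cl(B ∪ x)` number at least `3`
  set R := W.filter (fun x' => x' ∉ M.closure ((insert x B : Finset α) : Set α)) with hR
  have hcover : ((B ∪ W : Finset α) : Set α) ⊆ M.closure ((insert x B : Finset α) : Set α) ∪ (R : Set α) := by
    intro e he
    rw [Finset.coe_union, Set.mem_union, Finset.mem_coe, Finset.mem_coe] at he
    by_cases hecl : e ∈ M.closure ((insert x B : Finset α) : Set α)
    · exact Or.inl hecl
    · rcases he with heB | heW
      · exact absurd (M.mem_closure_of_mem' (Finset.mem_coe.2 (Finset.mem_insert_of_mem heB))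
          (by rw [← coe_gr M]; exact Finset.mem_coe.2 ((hB.trans (mem_planes.1 hG).1) heB))) hecl
      · exact Or.inr (Finset.mem_coe.2 (Finset.mem_filter.2 ⟨heW, hecl⟩))
  have hbound : M.eRk ((B ∪ W : Finset α) : Set α) ≤ 4 + (R.card : ℕ∞) := by
    calc M.eRk ((B ∪ W : Finset α) : Set α)
        ≤ M.eRk (M.closure ((insert x B : Finset α) : Set α) ∪ (R : Set α)) := M.eRk_mono hcover
      _ ≤ M.eRk (M.closure ((insert x B : Finset α) : Set α)) + (R : Set α).encard :=
          M.eRk_union_le_eRk_add_encard _ _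
      _ = 4 + (R.card : ℕ∞) := by rw [M.eRk_closure_eq, hr4, Set.encard_coe_eq_coe_finsetCard]
  rw [hBW] at hbound
  have hR3 : 3 ≤ R.card := by
    have h : (7 : ℕ∞) ≤ ((4 + R.card : ℕ) : ℕ∞) := by push_cast; exact hbound
    have h' : 7 ≤ 4 + R.card := by exact_mod_cast h
    omega
  -- `W ∖ x = (lossy) ⊔ (R ∖ x)` and `x ∉ R`
  have hxR : x ∉ R := by
    intro hxR
    rw [hR, Finset.mem_filter] at hxR
    exact hxR.2 (M.mem_closure_of_mem' (Finset.mem_coe.2 (Finset.mem_insert_self _ _))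
      (by rw [← coe_gr M]; exact Finset.mem_coe.2 (hW hx)))
  have hsplit : (W.erase x).card = ((W.erase x).filter (fun x' => x' ∈ M.closure ((insert x B : Finset α) : Set α))).card
      + R.card := by
    have h1 := Finset.card_filter_add_card_filter_not
      (s := W.erase x) (fun x' => x' ∈ M.closure ((insert x B : Finset α) : Set α))
    have h2 : (W.erase x).filter (fun x' => ¬ x' ∈ M.closure ((insert x B : Finset α) : Set α)) = R := by
      ext e
      rw [Finset.mem_filter, Finset.mem_erase, hR, Finset.mem_filter]
      constructor
      · rintro ⟨⟨-, heW⟩, hecl⟩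
        exact ⟨heW, hecl⟩
      · rintro ⟨heW, hecl⟩
        refine ⟨⟨?_, heW⟩, hecl⟩
        rintro rfl
        exact hecl (M.mem_closure_of_mem' (Finset.mem_coe.2 (Finset.mem_insert_self _ _))
          (by rw [← coe_gr M]; exact Finset.mem_coe.2 (hW heW)))
    rw [h2] at h1
    exact h1.symm
  have hWx : (W.erase x).card = W.card - 1 := Finset.card_erase_of_mem hx
  omega

/-- The pair witnesses of one point `x`: summed over the other `6` points of `W`, the shares of `B ∪ {x, x′}` are at least
`3·(3/14) + 3·(3/32) = 207/224` (at most `3` lossy partners at `3/32`, the rest generic at `3/14`). -/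
theorem sum_pair_shares_ge (hs : Simple M) {G B W : Finset α} (hG : G ∈ planes M) (hB : B ⊆ G)
    (hrB : M.eRk (B : Set α) = 3) (hb : 4 ≤ B.card) (hW : W ⊆ gr M) (hWG : Disjoint W G) (hW7 : W.card = 7)
    (hBW : M.eRk ((B ∪ W : Finset α) : Set α) = 7) {x : α} (hx : x ∈ W) :
    (207 / 224 : ℚ) ≤ ∑ x' ∈ W.erase x, fRule M G (insert x (insert x' B)) / D M (insert x (insert x' B)) := by
  classical
  have hWG' : ∀ y ∈ W, y ∉ G := fun y hy => Finset.disjoint_left.1 hWG hy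
  set L := (W.erase x).filter (fun x' => x' ∈ M.closure ((insert x B : Finset α) : Set α)) with hL
  have hL3 : L.card ≤ 3 := card_lossy_le_three hG hB hrB hW hWG hW7 hBW hx
  have hWx : (W.erase x).card = 6 := by rw [Finset.card_erase_of_mem hx, hW7]
  -- termwise: lossy partners `≥ 3/32`, the others `≥ 3/14`
  have hterm : ∀ x' ∈ W.erase x, (if x' ∈ L then (3 / 32 : ℚ) else 3 / 14) ≤
      fRule M G (insert x (insert x' B)) / D M (insert x (insert x' B)) := by
    intro x' hx'
    have hx'W : x' ∈ W := Finset.mem_of_mem_erase hx'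
    have hxx' : x ≠ x' := fun h => (Finset.ne_of_mem_erase hx') h.symm
    by_cases hl : x' ∈ L
    · rw [if_pos hl]
      exact share_pair_ge hs hG hB hrB hb (hW hx) (hW hx'W) hxx' (hWG' x hx) (hWG' x' hx'W)
    · rw [if_neg hl]
      have hx'cl : x' ∉ M.closure ((insert x B : Finset α) : Set α) := fun h =>
        hl (Finset.mem_filter.2 ⟨hx', h⟩)
      have hr5 : M.eRk ((insert x (insert x' B) : Finset α) : Set α) = 5 := by
        rw [Finset.insert_comm]
        have h := eRk_insert_eq_succ_of_notMem_closure' (F := insert x B) (hW hx'W) hx'cl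
        rw [h, eRk_insert_eq_four hG hB hrB (hW hx) (hWG' x hx)]
        rfl
      exact share_pair_generic_ge hs hG hB hrB hb (hW hx) (hW hx'W) hxx' (hWG' x hx) (hWG' x' hx'W) hr5
  calc (207 / 224 : ℚ) ≤ ∑ x' ∈ W.erase x, (if x' ∈ L then (3 / 32 : ℚ) else 3 / 14) := by
        rw [Finset.sum_ite, Finset.sum_const, Finset.sum_const, nsmul_eq_mul, nsmul_eq_mul]
        have hLsub : (W.erase x).filter (fun x' => x' ∈ L) = L := by
          ext e
          rw [Finset.mem_filter, hL, Finset.mem_filter]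
          constructor
          · rintro ⟨-, h⟩; exact h
          · intro h; exact ⟨h.1, h⟩
        have hcompl : ((W.erase x).filter (fun x' => x' ∉ L)).card = 6 - L.card := by
          have := Finset.card_filter_add_card_filter_not (s := W.erase x) (fun x' => x' ∈ L)
          rw [hLsub, hWx] at this
          omega
        rw [hLsub, hcompl]
        have hcast : ((6 - L.card : ℕ) : ℚ) = 6 - (L.card : ℚ) := by
          rw [Nat.cast_sub (by omega)]
          norm_num
        rw [hcast]
        have : (L.card : ℚ) ≤ 3 := by exact_mod_cast hL3
        nlinarith
    _ ≤ ∑ x' ∈ W.erase x, fRule M G (insert x (insert x' B)) / D M (insert x (insert x' B)) :=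
        Finset.sum_le_sum hterm

/-- **Double counting**: the sum over ordered pairs `(x, x′)` of distinct points of `W` of `f {x, x′}` is at most twice the
sum over the `2`-subsets (each `2`-subset is hit by at most two ordered pairs), for `f ≥ 0`. -/
theorem sum_erase_le_two_mul_sum_powersetCard_two (W : Finset α) (f : Finset α → ℚ) (hf : ∀ X, 0 ≤ f X) :
    ∑ x ∈ W, ∑ x' ∈ W.erase x, f {x, x'} ≤ 2 * ∑ X ∈ W.powersetCard 2, f X := by
  classical
  set P := (W ×ˢ W).filter (fun p : α × α => p.1 ≠ p.2) with hP
  -- the ordered pairs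
  have h1 : ∑ x ∈ W, ∑ x' ∈ W.erase x, f {x, x'} = ∑ p ∈ P, f {p.1, p.2} := by
    rw [hP, Finset.sum_filter, Finset.sum_product]
    apply Finset.sum_congr rfl
    intro x _
    rw [← Finset.sum_filter]
    change _ = ∑ a ∈ W.filter (fun a => x ≠ a), f {x, a}
    rw [Finset.filter_ne]
  rw [h1]
  have hmaps : ∀ p ∈ P, ({p.1, p.2} : Finset α) ∈ W.powersetCard 2 := by
    intro p hp
    rw [hP, Finset.mem_filter, Finset.mem_product] at hp
    rw [Finset.mem_powersetCard]
    refine ⟨?_, Finset.card_pair hp.2⟩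
    intro e he
    rw [Finset.mem_insert, Finset.mem_singleton] at he
    rcases he with rfl | rfl
    · exact hp.1.1
    · exact hp.1.2
  rw [← Finset.sum_fiberwise_of_maps_to hmaps, Finset.mul_sum]
  apply Finset.sum_le_sum
  intro X hX
  rw [Finset.mem_powersetCard] at hX
  have hfib : ∀ p ∈ P.filter (fun p => ({p.1, p.2} : Finset α) = X), f {p.1, p.2} = f X := by
    intro p hp
    rw [Finset.mem_filter] at hp
    rw [hp.2]
  rw [Finset.sum_congr rfl hfib, Finset.sum_const, nsmul_eq_mul]
  apply mul_le_mul_of_nonneg_right _ (hf X)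
  -- the fibre over `X = {x, x′}` lies in `{(x, x′), (x′, x)}`
  obtain ⟨x, x', hxx', rfl⟩ := Finset.card_eq_two.1 hX.2
  have hsub : P.filter (fun p => ({p.1, p.2} : Finset α) = {x, x'}) ⊆ {(x, x'), (x', x)} := by
    intro p hp
    rw [Finset.mem_filter, hP, Finset.mem_filter] at hp
    obtain ⟨⟨-, hne⟩, hpX⟩ := hp
    have h1 : p.1 ∈ ({x, x'} : Finset α) := by rw [← hpX]; exact Finset.mem_insert_self _ _
    have h2 : p.2 ∈ ({x, x'} : Finset α) := by rw [← hpX]; exact Finset.mem_insert_of_mem (Finset.mem_singleton_self _)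
    rw [Finset.mem_insert, Finset.mem_singleton] at h1 h2
    rw [Finset.mem_insert, Finset.mem_singleton]
    rcases h1 with h1 | h1 <;> rcases h2 with h2 | h2
    · exact absurd (h1.trans h2.symm) hne
    · left; exact Prod.ext h1 h2
    · right; exact Prod.ext h1 h2
    · exact absurd (h1.trans h2.symm) hne
  have := Finset.card_le_card hsub
  have h2 : ({(x, x'), (x', x)} : Finset (α × α)).card ≤ 2 := Finset.card_le_two
  have h3 : (P.filter (fun p => ({p.1, p.2} : Finset α) = {x, x'})).card ≤ 2 := this.trans h2
  exact_mod_cast h3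

/-- **THEOREM P₂(7,3), the `|B| ≥ 4` step**: let `G` be a plane, `B ⊆ G` of rank `3` with `|B| ≥ 4`, and `W` a set of
`7` points outside `G` with `ρ(B ∪ W) = 7`. Then the single-point witnesses `B ∪ {x}` and the pair witnesses `B ∪ {x, x′}`,
all in any family `Y` containing every set of rank `4`, `5` or `6`, supply `≥ 28/5 = Φ(7,3)` to `B`. -/
theorem supply_ge_phi_of_four_le (hs : Simple M) {G B W : Finset α} (hG : G ∈ planes M) (hB : B ⊆ G)
    (hrB : M.eRk (B : Set α) = 3) (hb : 4 ≤ B.card) (hW : W ⊆ gr M) (hWG : Disjoint W G) (hW7 : W.card = 7)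
    (hBW : M.eRk ((B ∪ W : Finset α) : Set α) = 7) (Y : Finset (Finset α))
    (hY : ∀ S, S ⊆ gr M → (3 : ℕ∞) < M.eRk (S : Set α) → M.eRk (S : Set α) < 7 → S ∈ Y) :
    (28 / 5 : ℚ) ≤ ∑ S ∈ Y.filter (fun S => S ∩ G = B), fRule M G S / D M S := by
  classical
  have hBg : B ⊆ gr M := hB.trans (mem_planes.1 hG).1
  have hWB : ∀ x ∈ W, x ∉ B := fun x hx hxB => Finset.disjoint_left.1 hWG hx (hB hxB)
  have hWG' : ∀ x ∈ W, x ∉ G := fun x hx => Finset.disjoint_left.1 hWG hx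
  -- the single-point witnesses
  set T₁ := W.image (fun x => insert x B) with hT₁
  have hinj₁ : Set.InjOn (fun x => insert x B) (W : Set α) := by
    intro x hx x' hx' h
    simp only at h
    have : x ∈ insert x' B := by rw [← h]; exact Finset.mem_insert_self _ _
    rw [Finset.mem_insert] at this
    rcases this with rfl | hxB
    · rfl
    · exact absurd hxB (hWB x hx)
  have hT₁sub : T₁ ⊆ Y.filter (fun S => S ∩ G = B) := by
    intro S hS
    rw [hT₁, Finset.mem_image] at hS
    obtain ⟨x, hx, rfl⟩ := hS
    rw [Finset.mem_filter]
    have hr4 := eRk_insert_eq_four hG hB hrB (hW hx) (hWG' x hx)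
    refine ⟨hY _ (Finset.insert_subset (hW hx) hBg) (by rw [hr4]; decide) (by rw [hr4]; decide), ?_⟩
    ext y
    rw [Finset.mem_inter, Finset.mem_insert]
    constructor
    · rintro ⟨rfl | hyB, hyG⟩
      · exact absurd hyG (hWG' y hx)
      · exact hyB
    · intro hyB
      exact ⟨Or.inr hyB, hB hyB⟩
  have hsum₁ : (7 : ℚ) * (2 / 5) ≤ ∑ S ∈ T₁, fRule M G S / D M S := by
    rw [hT₁, Finset.sum_image hinj₁]
    calc (7 : ℚ) * (2 / 5) = ∑ _x ∈ W, (2 / 5 : ℚ) := by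
          rw [Finset.sum_const, hW7, nsmul_eq_mul]; norm_num
      _ ≤ ∑ x ∈ W, fRule M G (insert x B) / D M (insert x B) :=
          Finset.sum_le_sum (fun x hx => share_single_ge hs hG hB hrB hb (hW hx) (hWG' x hx))
  -- the pair witnesses
  set T₂ := (W.powersetCard 2).image (fun X => X ∪ B) with hT₂
  have hinj₂ : Set.InjOn (fun X => X ∪ B) ((W.powersetCard 2 : Finset (Finset α)) : Set (Finset α)) := by
    intro X hX X' hX' h
    simp only [Finset.mem_coe, Finset.mem_powersetCard] at hX hX'
    simp only at h
    have hXB : Disjoint X B := Finset.disjoint_of_subset_left hX.1 hWG |>.mono_right hB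
    have hX'B : Disjoint X' B := Finset.disjoint_of_subset_left hX'.1 hWG |>.mono_right hB
    rw [← Finset.union_sdiff_cancel_right hXB, ← Finset.union_sdiff_cancel_right hX'B, h]
  have hT₂sub : T₂ ⊆ Y.filter (fun S => S ∩ G = B) := by
    intro S hS
    rw [hT₂, Finset.mem_image] at hS
    obtain ⟨X, hX, rfl⟩ := hS
    rw [Finset.mem_powersetCard] at hX
    obtain ⟨x, x', hxx', rfl⟩ := Finset.card_eq_two.1 hX.2
    have hx : x ∈ W := hX.1 (by simp)
    have hx' : x' ∈ W := hX.1 (by simp)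
    rw [pair_union_eq, Finset.mem_filter]
    have hr4 := eRk_insert_eq_four hG hB hrB (hW hx') (hWG' x' hx')
    have hge : (4 : ℕ∞) ≤ M.eRk ((insert x (insert x' B) : Finset α) : Set α) := by
      rw [← hr4]
      exact M.eRk_mono (Finset.coe_subset.2 (Finset.subset_insert _ _))
    have hle : M.eRk ((insert x (insert x' B) : Finset α) : Set α) ≤ 5 := by
      have := eRk_pair_insert_le (M := M) B x x'
      rw [hrB] at this
      exact this.trans (by norm_num)
    refine ⟨hY _ (Finset.insert_subset (hW hx) (Finset.insert_subset (hW hx') hBg))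
      (lt_of_lt_of_le (by decide) hge) (lt_of_le_of_lt hle (by decide)), pair_inter_eq hB (hWG' x hx) (hWG' x' hx')⟩
  -- the pair sum through the ordered pairs: each `x` contributes `≥ 207/224`
  have hsum₂ : (7 : ℚ) * (207 / 224) / 2 ≤ ∑ S ∈ T₂, fRule M G S / D M S := by
    rw [hT₂, Finset.sum_image hinj₂]
    have hord : (7 : ℚ) * (207 / 224) ≤
        ∑ x ∈ W, ∑ x' ∈ W.erase x, fRule M G ({x, x'} ∪ B) / D M ({x, x'} ∪ B) := by
      calc (7 : ℚ) * (207 / 224) = ∑ _x ∈ W, (207 / 224 : ℚ) := by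
            rw [Finset.sum_const, hW7, nsmul_eq_mul]; norm_num
        _ ≤ ∑ x ∈ W, ∑ x' ∈ W.erase x, fRule M G ({x, x'} ∪ B) / D M ({x, x'} ∪ B) := by
            apply Finset.sum_le_sum
            intro x hx
            have := sum_pair_shares_ge hs hG hB hrB hb hW hWG hW7 hBW hx
            simpa only [pair_union_eq] using this
    have hdc := sum_erase_le_two_mul_sum_powersetCard_two W (fun X => fRule M G (X ∪ B) / D M (X ∪ B))
      (fun X => div_nonneg (fRule_nonneg M G _) (D_nonneg M _))
    linarith
  -- the two families are disjoint (their members have sizes `|B| + 1` and `|B| + 2`)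
  have hdisj : Disjoint T₁ T₂ := by
    rw [Finset.disjoint_left]
    intro S hS₁ hS₂
    rw [hT₁, Finset.mem_image] at hS₁
    rw [hT₂, Finset.mem_image] at hS₂
    obtain ⟨x, hx, rfl⟩ := hS₁
    obtain ⟨X, hX, hXS⟩ := hS₂
    rw [Finset.mem_powersetCard] at hX
    have hXB : Disjoint X B := Finset.disjoint_of_subset_left hX.1 hWG |>.mono_right hB
    have hc1 : (insert x B).card = B.card + 1 := Finset.card_insert_of_notMem (hWB x hx)
    have hc2 : (X ∪ B).card = B.card + 2 := by
      rw [Finset.card_union_of_disjoint hXB, hX.2]; ring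
    rw [← hXS] at hc1
    omega
  calc (28 / 5 : ℚ) ≤ (7 : ℚ) * (2 / 5) + (7 : ℚ) * (207 / 224) / 2 := by norm_num
    _ ≤ ∑ S ∈ T₁, fRule M G S / D M S + ∑ S ∈ T₂, fRule M G S / D M S := add_le_add hsum₁ hsum₂
    _ = ∑ S ∈ T₁ ∪ T₂, fRule M G S / D M S := (Finset.sum_union hdisj).symm
    _ ≤ ∑ S ∈ Y.filter (fun S => S ∩ G = B), fRule M G S / D M S := by
        apply Finset.sum_le_sum_of_subset_of_nonneg (Finset.union_subset hT₁sub hT₂sub)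
        intro S _ _
        exact div_nonneg (fRule_nonneg M G S) (D_nonneg M S)

end SevenThree

end PercRepro
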